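import Summits.QuantumFields.BalabanUV.T4Continuum.Support.MinimalActionWitness
import HarnessLib

/-!
# T⁴ programme, node NE3 (η-rate of the minimisers) — THE ACTION SANDWICH, part 6: THE RE-CUT OF THE REFINEMENT
# HYPOTHESIS (H2) — a regular one-step refinement of the run-A minimiser is a KINEMATIC matter

Seventeenth generation of the NE3 prover lineage P1 of the cell `pub-balaban` (unit `b2b-balaban-t4-ne3-p1`, OWNER of
`BINDER-OWNERS.md` row NE3), file 6 of the «action sandwich» series (`MinimalActionLevels` ∕ `…Sandwich` ∕ `…Rate` ∕
`…Witness` ∕ `…Limit`).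

## What is re-cut, and why it matters

Part 3 (`MinimalActionRate`) proved the ACTION half of NE3, `T4EtaRateMin.ActionRate … (L⁻²)`, from the hypothesis
package `SandwichData` = ⟨(H1) minimisers exist, (H3) minimisers are `Regular`, (H4) class transport (a theorem for the
small-field class), (H2) every minimiser `U_k(V)` of run `k` is the exact one-step average (42) of SOME `Regular … (k+1)`
configuration⟩.  The owner skeleton (`t4/b2b-balaban-t4-ne3-p1/SKELETON-NE3-P1.md` v1, leaf A-H2b) had read the
GRADIENT clause of (H2) as «one dictionary step deeper than B11 Thm 1»: Lipschitz response of the ONE-STEP MINIMISER to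
its datum (B11 §E (116)–(121), Prop. 6 p. 295; Prop. 9 p. 309) × translation covariance — because the one-step
Theorem 1 alone sees only the plaquette SIZE `bη²` of the datum and returns a fine flux gradient `≲ bη²L^{−3}`, short of
the required `η′³ = (η/L)³` by the factor `η = L^{−k}`.

THE OBSERVATION OF THIS FILE: the lower half of the sandwich (`MinimalActionSandwich.minAct_succ_le_sub`) accepts ANY
admissible configuration of run `k+1` whose one-step average is `U_k(V)` — it need not be a minimiser of anything, and no
response of any minimiser is involved.  Hence (H2) follows from a purely KINEMATIC statement about Bałaban's average
(42) and the Wilson plaquettes, with NO reference to the variational problem: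

  `SmoothRefine 𝒞 L N b c b′ c′` (§2): every configuration `U ∈ 𝒞 j` which is `U(N)`-valued, `(N·L^j)`-periodic, in
  the small-field class of radius `b·(L^j)^{−2}` and with covariant flux gradient `≤ c·(L^j)^{−3}` POINTWISE
  (`RegularSup … j U`, §1 — the printed TYPE of B11 (8) + (10) read literally) is the exact rescaled one-step average
  `rescale L (bavg L Ũ) = U` of some `Ũ ∈ 𝒞 (j+1)` with `RegularSup … b′ c′ (j+1) Ũ`.

i.e. «a slowly varying small field on the `η`-lattice is the block average of a slowly varying small field on the
`η/L`-lattice, with `d, L`-dependent losses in the constants».  THEN (**`sandwichData_of_smoothRefine`**, §4):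
(H1) + (H3) in sup form + the datum's own level-0 regularity + (H4) + `SmoothRefine` ⇒ `SandwichData` (constants
`max b b′`, `gradConst d (max c c′)`), and (**`actionRate_sfClass_of_smoothRefine`**) the ACTION half of NE3 for the
small-field class follows with NO one-step minimiser, NO B11 §E response, NO covariance argument: the remaining
hypotheses are B11 Theorem 1 TYPE ((H1) existence (8); (H3) = (8) + (10) pointwise) and the kinematic lemma.

## Status of the kinematic lemma (honest)

`SmoothRefine` is OURS and is NOT proved here (it is the hypothesis `hR`; §5 shows the hypotheses of §4 are jointly
satisfiable on the flat class).  It is elementary lattice gauge kinematics, manuscript-free; its natural proof (the row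
owner's plan, skeleton v1.1 §3 leaves R1–R2) is a cell-by-cell covariant filling of the refined lattice in increasing
dimension with evenly split fluxes and a pre-compensated 1-skeleton (ancestry, none of which proves the flux-GRADIENT
bound or exactness for (42): Lüscher, Commun. Math. Phys. 85 (1982) 39–48 (cell-by-cell interpolation of lattice gauge
fields under a small-plaquette bound); 't Hooft, Phys. Lett. B 349 (1995) 491; Endres–Brower–Detmold–Orginos–Pochinsky,
Phys. Rev. D 92 (2015) 114516, §3 «prolongation … interpolation proceeds from low dimensional to high dimensional
cells»), followed by an EXACT correction of the block-average constraint by a contraction mapping which is LOCAL — one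
matrix fixed point per coarse bond, because the loop variables `Wcx` of (42) see a modification of the chain-end bond
`⟨Lq + (L−1)e_κ, Lq + Le_κ⟩` only through `Ad_{V(c)}(·)` off the skeleton line and not at all on it (this lineage's
implicit-function technique; module `BlockAverageChainEnd*` of this generation).

HONEST FRAMING.  Finite-T⁴ ultraviolet bookkeeping about MINIMISERS (rung (B)+1 of the cell's ladder); nothing here
is an estimate; no conditional of the cell (`BetaPertH`, (B), (B^μ)) is used or hidden; nothing bears on infinite
volume, a mass gap, or the Clay problem; **NE3 is NOT proved** — (H1), (H3), the level-0 regularity of the datum and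
`SmoothRefine` are hypotheses, asserted for no configuration.  ABSOLUTE RULE of the cell kept: no printed sentence is a
hypothesis of any declaration (`RegularSup` ∕ `SmoothRefine` are SHAPES over the tree's objects); no `sorry`, no axioms
beyond Mathlib's.  PLACEMENT (human rule 2026-08-19): cell work under `Summits/QuantumFields/BalabanUV/`; imports the
accepted `Support.MinimalActionWitness` (p204967) only; moves nothing.  Records: `t4/T4-EST-U1b-OSC.md`,
`t4/T4-EST-NE3-P1.md`, skeleton `t4/b2b-balaban-t4-ne3-p1/SKELETON-NE3-P1.md` of the cell `pub-balaban`.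
-/

set_option autoImplicit false

open scoped BigOperators Matrix Matrix.Norms.L2Operator
open NormedSpace Finset

namespace Summit.QuantumFields.BalabanUV.T4Continuum.MinimalActionRefine

open Literature.MathematicalPhysics.QuantumFieldTheory.Balaban1983to89
open B7Prop1Explicit B7Prop2Explicit MatrixLog UnitaryModel
open T4AveragingDeficitWall hiding Site Plane Plaq Bond
open T4AveragingDeficitWallBoundary (IsPeriodicCfg periodBox blockSites_periodBox mem_periodBox card_periodBox)
open T4AveragingDeficitNonAbelian (wallConstNA wallConstNA_nonneg abs_deficit_torus_le)
open T4EtaRateMin (Readings ActionRate)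
open MinimalActionLevels MinimalActionSandwich MinimalActionRate MinimalActionWitness

noncomputable section

variable {d : ℕ} {n : Type*} [Fintype n] [DecidableEq n]

local notation "𝕄" => Matrix n n ℂ
local notation "Site" => B7Prop1Explicit.Site

/-! ## §1 Printed-TYPE regularity in sup form -/

variable (d) in
/-- **SUP-FORM REGULARITY OF A LEVEL-`j` CONFIGURATION** (a SHAPE; dictionary: B11 Thm 1 (8) + (10) for a minimal
configuration at spacing `η = L^{−j}` on the torus of side `N`, read on `ℤ^d` and read LITERALLY as pointwise bounds):
`U(N)`-valued; `(N·L^j)`-periodic; small field of radius `b·(L^j)^{−2}` («`|U(∂p) − 1| < B₃ε₁η²`», (2)∕(8)); covariant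
forward gradient of the flux `≤ c·(L^j)^{−3}` at EVERY bond and plane («`|∂^{η*}∂^ηA|, |Δ^ηA| < B₃Mε₁(L^jη)^{−3}`» (10)
in local gauges, i.e. `|∇_U F| ≲ ε₁η³` in lattice units).  Asserted for no configuration here; a hypothesis SHAPE of
ours, not a printed statement (context: [Balaban1985Variational] Thm 1 (8)–(10) p. 279).  Its `ℓ²` shadow is part 3's
`Regular` (`RegularSup.regular`). [folklore] -/
@[folklore]
structure RegularSup (L N : ℕ) (b c : ℝ) (j : ℕ) (U : Site d → Fin d → 𝕄ˣ) : Prop where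
  /-- `U(N)`-valued -/
  unitary : IsUnitaryCfg U
  /-- a configuration on the torus of side `N` at spacing `L^{−j}` -/
  periodic : IsPeriodicCfg U ((N * L ^ j : ℕ) : ℤ)
  /-- small field of radius `b η²`, `η = L^{−j}` -/
  small : SmallField U (b / ((L : ℝ) ^ j) ^ 2)
  /-- `|∇_U F| ≤ c η³` at every bond `⟨x, x + e_κ⟩` and every plane -/
  grad : ∀ (x : Site d) (κ : Fin d) (π : T4AveragingDeficitWall.Plane d),
    ‖covGrad U (flux U) x κ π‖ ≤ c / ((L : ℝ) ^ j) ^ 3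

variable (d) in
/-- The `ℓ²` gradient constant produced by a pointwise flux-gradient bound `c`: `d · #Plane(d) · c²` (part 3's
`regular_of_sup`; `#Plane(4) = 6`). [folklore] -/
def gradConst (c : ℝ) : ℝ := d * Fintype.card (T4AveragingDeficitWall.Plane d) * c ^ 2

omit [Fintype n] [DecidableEq n] in
/-- `0 ≤ gradConst d c`. [folklore] -/
theorem gradConst_nonneg (c : ℝ) : 0 ≤ gradConst d c := by
  unfold gradConst; positivity

omit [Fintype n] [DecidableEq n] in
/-- `gradConst` is monotone on `0 ≤ c`. [folklore] -/
theorem gradConst_mono {c c' : ℝ} (hc : 0 ≤ c) (hcc' : c ≤ c') : gradConst d c ≤ gradConst d c' := by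
  unfold gradConst
  exact mul_le_mul_of_nonneg_left (pow_le_pow_left₀ hc hcc' 2) (by positivity)

/-- **Sup-form regularity implies part 3's `ℓ²` regularity** with gradient constant `gradConst d c`
(`MinimalActionRate.regular_of_sup`). [folklore] -/
theorem RegularSup.regular {L N j : ℕ} {b c : ℝ} {U : Site d → Fin d → 𝕄ˣ} (h : RegularSup d L N b c j U) :
    Regular d L N b (gradConst d c) j U :=
  regular_of_sup h.unitary h.periodic h.small h.grad

/-- `RegularSup` is monotone in the regularity data `(b, c)`. [folklore] -/
theorem RegularSup.mono {L N j : ℕ} {b c b' c' : ℝ} {U : Site d → Fin d → 𝕄ˣ} (h : RegularSup d L N b c j U)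
    (hb : b ≤ b') (hc : c ≤ c') : RegularSup d L N b' c' j U where
  unitary := h.unitary
  periodic := h.periodic
  small := fun x κ κ' hκ => (h.small x κ κ' hκ).trans (div_le_div_of_nonneg_right hb (by positivity))
  grad := fun x κ π => (h.grad x κ π).trans (div_le_div_of_nonneg_right hc (by positivity))

/-! ## §2 The kinematic smooth-refinement shape -/

variable (d) in
/-- **THE KINEMATIC SMOOTH-REFINEMENT SHAPE** (OURS; a hypothesis SHAPE, asserted for no class here): within the class
family `𝒞`, every level-`j` configuration with sup-form regularity data `(b, c)` is the EXACT rescaled one-step average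
(42) `rescale L (bavg L Ũ) = U` of a level-`(j+1)` configuration `Ũ ∈ 𝒞 (j+1)` with sup-form regularity data `(b′, c′)`.
No minimiser, no variational problem, no response: a statement about (42) and Wilson plaquettes alone («a slowly
varying small field on the `η`-lattice is the block average of a slowly varying small field on the `η/L`-lattice»).
Context (ancestry of the intended proof, none of which states this): Lüscher, Commun. Math. Phys. 85 (1982) 39–48;
't Hooft, Phys. Lett. B 349 (1995) 491; Endres et al., Phys. Rev. D 92 (2015) 114516 §3. [folklore] -/
@[folklore]
def SmoothRefine (𝒞 : ℕ → Set (Site d → Fin d → 𝕄ˣ)) (L N : ℕ) (b c b' c' : ℝ) : Prop :=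
  ∀ (j : ℕ) (U : Site d → Fin d → 𝕄ˣ), U ∈ 𝒞 j → RegularSup d L N b c j U →
    ∃ Ut, Ut ∈ 𝒞 (j + 1) ∧ rescale L (bavg L Ut) = U ∧ RegularSup d L N b' c' (j + 1) Ut

/-- `SmoothRefine` is monotone in the OUTPUT data `(b′, c′)`. [folklore] -/
theorem SmoothRefine.mono {𝒞 : ℕ → Set (Site d → Fin d → 𝕄ˣ)} {L N : ℕ} {b c b' c' b'' c'' : ℝ}
    (h : SmoothRefine d 𝒞 L N b c b' c') (hb : b' ≤ b'') (hc : c' ≤ c'') : SmoothRefine d 𝒞 L N b c b'' c'' := by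
  intro j U hU hreg
  obtain ⟨Ut, hmem, havg, hreg'⟩ := h j U hU hreg
  exact ⟨Ut, hmem, havg, hreg'.mono hb hc⟩

/-- `SmoothRefine` is antitone in the INPUT data `(b, c)`. [folklore] -/
theorem SmoothRefine.anti {𝒞 : ℕ → Set (Site d → Fin d → 𝕄ˣ)} {L N : ℕ} {b c b' c' b₀ c₀ : ℝ}
    (h : SmoothRefine d 𝒞 L N b c b' c') (hb : b₀ ≤ b) (hc : c₀ ≤ c) : SmoothRefine d 𝒞 L N b₀ c₀ b' c' :=
  fun j U hU hreg => h j U hU (hreg.mono hb hc)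

/-! ## §3 Level `0`: the minimiser is the datum -/

/-- At level `0` the admissible set is `{V} ∩ 𝒞 0` (the `0`-fold average (43) is the identity), so a level-`0`
minimiser IS the datum. [folklore] -/
theorem eq_of_isMinimiser_zero {𝒞 : ℕ → Set (Site d → Fin d → 𝕄ˣ)} {L N : ℕ} {V U : Site d → Fin d → 𝕄ˣ}
    (h : IsMinimiser d 𝒞 L N 0 V U) : U = V :=
  h.mem.2

/-- Hence the regularity of a level-`0` minimiser is the regularity of the datum. [folklore] -/
theorem regularSup_of_isMinimiser_zero {𝒞 : ℕ → Set (Site d → Fin d → 𝕄ˣ)} {L N : ℕ} {b c : ℝ}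
    {V U : Site d → Fin d → 𝕄ˣ} (h0 : RegularSup d L N b c 0 V) (h : IsMinimiser d 𝒞 L N 0 V U) :
    RegularSup d L N b c 0 U := by
  rw [eq_of_isMinimiser_zero h]; exact h0

/-! ## §4 THE RE-CUT: `SandwichData` and the action rate from the kinematic lemma -/

/-- **THE RE-CUT OF (H2)** — `SandwichData` from: (H1) minimisers exist at every level; (H3ˢᵘᵖ) every minimiser of run
`k+1` has sup-form regularity `(b, c)` (B11 Thm 1 (8)+(10) TYPE); (H0) the datum `V` itself has sup-form regularity
`(b, c)` at level `0` (the level-`0` minimiser IS `V`); (H4) class transport of the averaged minimiser; and the KINEMATIC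
lemma `SmoothRefine 𝒞 L N b c b′ c′`.  The refinement of the run-`k` minimiser is then whatever the kinematic lemma
returns for it — no one-step minimiser, no response, no covariance.  Constants: `(max b b′, gradConst d (max c c′))`
(minimisers and refinements share one pair by monotonicity). NE3 is NOT proved: every input is a hypothesis SHAPE.
[folklore] -/
theorem sandwichData_of_smoothRefine {𝒞 : ℕ → Set (Site d → Fin d → 𝕄ˣ)} {L N : ℕ} {b c b' c' : ℝ}
    {V : Site d → Fin d → 𝕄ˣ} (h1 : ∀ k : ℕ, ∃ U, IsMinimiser d 𝒞 L N k V U)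
    (h3 : ∀ (k : ℕ) (U : Site d → Fin d → 𝕄ˣ), IsMinimiser d 𝒞 L N (k + 1) V U → RegularSup d L N b c (k + 1) U)
    (h0 : RegularSup d L N b c 0 V)
    (h4 : ∀ (k : ℕ) (U : Site d → Fin d → 𝕄ˣ), IsMinimiser d 𝒞 L N (k + 1) V U → rescale L (bavg L U) ∈ 𝒞 k)
    (hR : SmoothRefine d 𝒞 L N b c b' c') :
    SandwichData d 𝒞 L N (max b b') (gradConst d (max c c')) V where
  exists_minimiser := h1
  regular := fun k U hU =>
    ((h3 k U hU).mono (le_max_left _ _) (le_max_left _ _)).regular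
  avg_mem := h4
  refine := by
    intro k U hU
    -- sup-form regularity of the run-`k` minimiser: the datum at level `0`, (H3ˢᵘᵖ) above it
    have hreg : RegularSup d L N b c k U := by
      cases k with
      | zero => exact regularSup_of_isMinimiser_zero h0 hU
      | succ k => exact h3 k U hU
    obtain ⟨Ut, hmem, havg, hreg'⟩ := hR k U hU.mem.1 hreg
    exact ⟨Ut, hmem, havg, ((hreg'.mono (le_max_right _ _) (le_max_right _ _)).regular)⟩

/-- **THE RE-CUT FOR THE SMALL-FIELD CLASS** (`sfClass L N ε`, B11's space (6)): (H4) is part 3's theorem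
`rescale_bavg_mem_sfClass` (B7 Prop. 1), so `SandwichData` reduces to (H1) existence, (H3ˢᵘᵖ) sup-form regularity of
the minimisers, (H0) sup-form regularity of the datum, and the kinematic lemma on the small-field class. [folklore] -/
theorem sandwichData_sfClass_of_smoothRefine [Nonempty n] {L N : ℕ} (hL : 1 ≤ L) {b c b' c' ε : ℝ} (hb : 0 ≤ b)
    (hbs : 512 * (d + 1) * (d + 4) * (L : ℝ) ^ 2 * b ≤ 1) (hbε : b + 226 * (8 * (d + 1) * (d + 4)) ^ 2 * b ^ 2 ≤ ε)
    {V : Site d → Fin d → 𝕄ˣ} (h1 : ∀ k : ℕ, ∃ U, IsMinimiser d (sfClass d L N ε) L N k V U)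
    (h3 : ∀ (k : ℕ) (U : Site d → Fin d → 𝕄ˣ),
      IsMinimiser d (sfClass d L N ε) L N (k + 1) V U → RegularSup d L N b c (k + 1) U)
    (h0 : RegularSup d L N b c 0 V)
    (hR : SmoothRefine d (sfClass (n := n) d L N ε) L N b c b' c') :
    SandwichData d (sfClass d L N ε) L N (max b b') (gradConst d (max c c')) V :=
  sandwichData_of_smoothRefine h1 h3 h0
    (fun k U hU => rescale_bavg_mem_sfClass hL hb hbs hbε (h3 k U hU).regular) hR

/-- **NE3, ACTION HALF, FOR THE SMALL-FIELD CLASS, FROM THE KINEMATIC LEMMA** — `T4EtaRateMin.ActionRate` BY NAME with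
rate `θ = L^{−2}`: on the set of data `V` of sup-form regularity `(b, c)` at level `0` for which minimisers exist at
every level (B11 Thm 1 (8) TYPE) with sup-form regularity `(b, c)` (B11 Thm 1 (8)+(10) TYPE), and GIVEN the kinematic
smooth-refinement lemma on the small-field class with output data `(b′, c′)`, the minimal actions obey
`|A_{k+1}(V) − A_k(V)| ≤ [wallConstNA(d,L)·(gradConst d (max c c′) + (max b b′)³)/L²]·(L^{−2})^k·N^d` for all `k`.
NO one-step minimiser, NO B11 §E response, NO β ∕ ML ∕ R0 ∕ γ ∕ δ ∕ (W1) ∕ (W2).  NE3 is NOT proved: (H1), (H3ˢᵘᵖ),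
(H0) and `SmoothRefine` are hypotheses, and nothing is said about `LocalRate` of the supplied `loc`. [folklore] -/
theorem actionRate_sfClass_of_smoothRefine [Nonempty n] {L N : ℕ} (hL : 1 ≤ L) (hN : 1 ≤ N) {b c b' c' ε : ℝ}
    (hb : 0 ≤ b) (hBs : 512 * (d + 1) * (d + 4) * (L : ℝ) ^ 2 * max b b' ≤ 1)
    (hbε : b + 226 * (8 * (d + 1) * (d + 4)) ^ 2 * b ^ 2 ≤ ε) {dom : Set (Site d → Fin d → 𝕄ˣ)}
    (h1 : ∀ V ∈ dom, ∀ k : ℕ, ∃ U, IsMinimiser d (sfClass d L N ε) L N k V U)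
    (h3 : ∀ V ∈ dom, ∀ (k : ℕ) (U : Site d → Fin d → 𝕄ˣ),
      IsMinimiser d (sfClass d L N ε) L N (k + 1) V U → RegularSup d L N b c (k + 1) U)
    (h0 : ∀ V ∈ dom, RegularSup d L N b c 0 V)
    (hR : SmoothRefine d (sfClass (n := n) d L N ε) L N b c b' c')
    {X : Type*} (loc : ℕ → (Site d → Fin d → 𝕄ˣ) → X → ℝ) :
    ActionRate (minActReadings d (sfClass d L N ε) L N dom loc)
      (wallConstNA d L * (gradConst d (max c c') + (max b b') ^ 3) / (L : ℝ) ^ 2) (((L : ℝ) ^ 2)⁻¹) := by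
  have hbs : 512 * (d + 1) * (d + 4) * (L : ℝ) ^ 2 * b ≤ 1 := by
    have h512 : (0 : ℝ) ≤ 512 * (d + 1) * (d + 4) * (L : ℝ) ^ 2 := by positivity
    exact (mul_le_mul_of_nonneg_left (le_max_left b b') h512).trans hBs
  exact actionRate_of_sandwichData hL hN (le_max_of_le_left hb) hBs
    (fun V hV => sandwichData_sfClass_of_smoothRefine hL hb hbs hbε (h1 V hV) (h3 V hV) (h0 V hV) hR) loc

/-! ## §5 Non-vacuity: the flat class -/

/-- The flat configuration has sup-form regularity `(b, c)` at every level for all `b, c ≥ 0`. [folklore] -/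
theorem regularSup_flatCfg (L N j : ℕ) {b c : ℝ} (hb : 0 ≤ b) (hc : 0 ≤ c) :
    RegularSup d L N b c j (flatCfg : Site d → Fin d → 𝕄ˣ) where
  unitary := (regular_flatCfg (d := d) (n := n) L N j hb le_rfl : Regular d L N b 0 j flatCfg).unitary
  periodic := isPeriodicCfg_flatCfg _
  small := (regular_flatCfg (d := d) (n := n) L N j hb le_rfl : Regular d L N b 0 j flatCfg).small
  grad := fun x κ π => by
    have : covGrad (flatCfg : Site d → Fin d → 𝕄ˣ) (flux flatCfg) x κ π = 0 := by
      unfold covGrad Ad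
      simp only [flux_flatCfg, mul_zero, zero_mul, sub_zero]
    rw [this, norm_zero]
    positivity

/-- **`SmoothRefine` HOLDS ON THE FLAT CLASS** (the singleton family `{1}`): the flat configuration refines itself
(`rescale L (bavg L 1) = 1`, tree `bavg_flat`). [folklore] -/
theorem smoothRefine_flatClass (L N : ℕ) {b c b' c' : ℝ} (hb' : 0 ≤ b') (hc' : 0 ≤ c') :
    SmoothRefine d (flatClass : ℕ → Set (Site d → Fin d → 𝕄ˣ)) L N b c b' c' := by
  intro j U hU _
  obtain rfl : U = flatCfg := Set.mem_singleton_iff.mp hU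
  exact ⟨flatCfg, Set.mem_singleton _, rescale_bavg_flatCfg L, regularSup_flatCfg L N (j + 1) hb' hc'⟩

/-- **JOINT SATISFIABILITY OF THE HYPOTHESES OF THE RE-CUT**: on the flat class with the flat datum, (H1), (H3ˢᵘᵖ),
(H0), (H4) and `SmoothRefine` all hold, and `sandwichData_of_smoothRefine` applies (for all `b, c, b′, c′ ≥ 0`).
[folklore] -/
theorem sandwichData_flatCfg_of_smoothRefine (L N : ℕ) {b c b' c' : ℝ} (hb : 0 ≤ b) (hc : 0 ≤ c) (hb' : 0 ≤ b')
    (hc' : 0 ≤ c') :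
    SandwichData d flatClass L N (max b b') (gradConst d (max c c')) (flatCfg : Site d → Fin d → 𝕄ˣ) :=
  sandwichData_of_smoothRefine (fun k => ⟨flatCfg, isMinimiser_flatCfg L N k⟩)
    (fun k U hU => by rw [eq_flatCfg_of_isMinimiser hU]; exact regularSup_flatCfg L N (k + 1) hb hc)
    (regularSup_flatCfg L N 0 hb hc)
    (fun k U hU => by
      rw [eq_flatCfg_of_isMinimiser hU, rescale_bavg_flatCfg]; exact Set.mem_singleton _)
    (smoothRefine_flatClass L N hb' hc')

end

end Summit.QuantumFields.BalabanUV.T4Continuum.MinimalActionRefine
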